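import Summits.Ventures.DiscreteObjects.Hadamard.FixedSubmatrix41

/-!
# Hadamard matrices with a signed automorphism of odd prime order: fixed rows are orthogonal on the fixed columns (kernel, general)

Framing: lottery ticket; floor = certified bounds/negative ranges.

Cell pub-namedobj (venture DiscreteObjects), target (H), hadamard gen 7.  Generalisation of `FixedSubmatrix41`: let `H` be a
Hadamard matrix (any order) with a signed-permutation automorphism `(π, κ, d, e)`, `κ ^ p = 1` for an odd prime `p`, and suppose
`κ` fixes FEWER THAN `p` columns.  Then any two distinct `π`-fixed rows are orthogonal on the fixed columns (and on the moved
columns).  Consequently the fixed submatrix `F` (fixed rows × fixed columns) satisfies `F Fᵀ = f·I` with `f` = number of fixed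
columns: for H(668) this is the Hadamard-form identity (R3) of FAMILY-F12-G7 §2 for every prime in the census (p = 83: `F` is a
Hadamard matrix of order 4; p = 41: order 12; p = 37: order 2).  Proof as in `FixedSubmatrix41`: the product of two fixed rows is
constant along `κ`-orbits (the sign `d u * d u'` must be `+1`, else `p` odd iterations negate a `±1`), so the moved part of the
vanishing inner product is divisible by `p`, hence so is the fixed part, whose absolute value is `< p`.
Ours, not literature; no `sorry`.
-/

open Finset BigOperators Matrix

namespace Summit.Ventures.DiscreteObjects.Hadamard

open Literature.Combinatorics.Designs.GoethalsSeidel (IsHadamardMatrix)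

variable {ι : Type*} [Fintype ι] [DecidableEq ι]

/-- for odd `p` with `κ ^ p = 1`, the sign characters of two `π`-fixed rows agree: `d u * d u' = 1` -/
lemma fixedRows_sign_eq_odd {H : Matrix ι ι ℤ} (hH : IsHadamardMatrix H) {π κ : Equiv.Perm ι} {d e : ι → ℤ}
    (haut : IsSignedAut H π κ d e) {p : ℕ} (hodd : Odd p) (hκ : κ ^ p = 1) {u u' : ι} (hu : π u = u) (hu' : π u' = u')
    (j : ι) : d u * d u' = 1 := by
  have hd := haut.1
  have hprod : d u * d u' = 1 ∨ d u * d u' = -1 := by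
    rcases hd u with h | h <;> rcases hd u' with h' | h' <;> simp [h, h']
  rcases hprod with h | h
  · exact h
  · exfalso
    have key := fixedRows_prod_pow haut hu hu' p j
    rw [hκ, Equiv.Perm.one_apply, h, Odd.neg_one_pow hodd] at key
    have hne : H u j * H u' j ≠ 0 := mul_ne_zero (pm_ne_zero (hH.1 u j)) (pm_ne_zero (hH.1 u' j))
    have : (H u j * H u' j) * 2 = 0 := by linarith
    rcases mul_eq_zero.mp this with h0 | h0
    · exact hne h0
    · norm_num at h0

/-- **Fixed rows are orthogonal on the fixed columns** whenever fewer than `p` columns are fixed (`p` an odd prime, `κ^p = 1`). -/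
theorem hadamard_fixedRows_orth_of_card_lt {H : Matrix ι ι ℤ} (hH : IsHadamardMatrix H)
    (π κ : Equiv.Perm ι) (d e : ι → ℤ) (haut : IsSignedAut H π κ d e)
    {p : ℕ} (hp : p.Prime) (hodd : Odd p) (hκ : κ ^ p = 1)
    (hlt : (univ.filter fun j => κ j = j).card < p)
    {u u' : ι} (hu : π u = u) (hu' : π u' = u') (huu' : u ≠ u') :
    ∑ j ∈ univ.filter (fun j => κ j = j), H u j * H u' j = 0 ∧
    ∑ j ∈ univ.filter (fun j => κ j ≠ j), H u j * H u' j = 0 := by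
  have htot : ∑ j, H u j * H u' j = 0 := hadamard_row_orth H hH huu'
  have hsplit : ∑ j, H u j * H u' j =
      ∑ j ∈ univ.filter (fun j => κ j = j), H u j * H u' j + ∑ j ∈ univ.filter (fun j => κ j ≠ j), H u j * H u' j := by
    rw [← Finset.sum_filter_add_sum_filter_not univ (fun j => κ j = j)]
  have hsign : d u * d u' = 1 := by
    obtain ⟨j₀⟩ : Nonempty ι := ⟨u⟩
    exact fixedRows_sign_eq_odd hH haut hodd hκ hu hu' j₀
  have hdvd : (p : ℤ) ∣ ∑ j ∈ univ.filter (fun j => κ j ≠ j), H u j * H u' j :=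
    dvd_sum_moved κ hp hκ (fun j => H u j * H u' j) (by
      intro y₀ _ i
      have e := fixedRows_prod_pow haut hu hu' i y₀
      rw [hsign, one_pow, one_mul] at e
      exact e)
  have hbound : |∑ j ∈ univ.filter (fun j => κ j = j), H u j * H u' j| < p := by
    calc |∑ j ∈ univ.filter (fun j => κ j = j), H u j * H u' j|
        ≤ ∑ j ∈ univ.filter (fun j => κ j = j), |H u j * H u' j| := Finset.abs_sum_le_sum_abs _ _
      _ = ∑ j ∈ univ.filter (fun j => κ j = j), (1 : ℤ) := by
          apply Finset.sum_congr rfl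
          intro j _
          rw [abs_mul]
          have a1 : |H u j| = 1 := by rcases hH.1 u j with h | h <;> simp [h]
          have a2 : |H u' j| = 1 := by rcases hH.1 u' j with h | h <;> simp [h]
          rw [a1, a2, mul_one]
      _ = ((univ.filter fun j => κ j = j).card : ℤ) := by rw [Finset.sum_const, nsmul_eq_mul, mul_one]
      _ < p := by exact_mod_cast hlt
  have hfix_dvd : (p : ℤ) ∣ ∑ j ∈ univ.filter (fun j => κ j = j), H u j * H u' j := by
    have e : ∑ j ∈ univ.filter (fun j => κ j = j), H u j * H u' j =
        -(∑ j ∈ univ.filter (fun j => κ j ≠ j), H u j * H u' j) := by linarith [hsplit, htot]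
    rw [e]; exact (dvd_neg).mpr hdvd
  have hfix : ∑ j ∈ univ.filter (fun j => κ j = j), H u j * H u' j = 0 := by
    obtain ⟨k, hk⟩ := hfix_dvd
    have hpk : |(p : ℤ) * k| < p := by rw [← hk]; exact hbound
    rw [abs_mul] at hpk
    have hp0 : (0 : ℤ) < p := by exact_mod_cast hp.pos
    have habs : |(p : ℤ)| = p := abs_of_pos hp0
    rw [habs] at hpk
    have hlt1 : |k| < 1 := by
      by_contra hc
      have hc' : 1 ≤ |k| := le_of_not_gt hc
      have : (p : ℤ) * 1 ≤ (p : ℤ) * |k| := by exact mul_le_mul_of_nonneg_left hc' hp0.le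
      linarith
    have hk0 : k = 0 := by
      have := abs_lt.mp hlt1
      omega
    rw [hk, hk0, mul_zero]
  refine ⟨hfix, ?_⟩
  linarith [hsplit, htot]

/-- **Order 83: the fixed 4×4 submatrix of H(668) is a Hadamard matrix of order 4** (with `hadamard668_fixedRows_83`:
exactly 4 fixed rows and columns). -/
theorem hadamard668_fixedSubmatrix_83 {H : Matrix ι ι ℤ} (hH : IsHadamardMatrix H) (hι : Fintype.card ι = 668)
    (π κ : Equiv.Perm ι) (d e : ι → ℤ) (haut : IsSignedAut H π κ d e)
    (hπ : π ^ 83 = 1) (hκ : κ ^ 83 = 1) (hne : π ≠ 1 ∨ κ ≠ 1) :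
    (univ.filter fun i => π i = i).card = 4 ∧ (univ.filter fun j => κ j = j).card = 4 ∧
    ∀ u u' : ι, π u = u → π u' = u' →
      ∑ j ∈ univ.filter (fun j => κ j = j), H u j * H u' j = if u = u' then 4 else 0 := by
  have hcount := hadamard668_fixedRows_83 hH hι π κ d e haut hπ hκ hne
  refine ⟨hcount.1, hcount.2, ?_⟩
  intro u u' hu hu'
  by_cases huu' : u = u'
  · subst huu'
    rw [if_pos rfl]
    calc ∑ j ∈ univ.filter (fun j => κ j = j), H u j * H u j
        = ∑ j ∈ univ.filter (fun j => κ j = j), (1 : ℤ) := by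
          apply Finset.sum_congr rfl
          intro j _
          exact pm_mul_self (hH.1 u j)
      _ = 4 := by rw [Finset.sum_const, nsmul_eq_mul, mul_one, hcount.2]; norm_num
  · rw [if_neg huu']
    have hlt : (univ.filter fun j => κ j = j).card < 83 := by rw [hcount.2]; norm_num
    exact (hadamard_fixedRows_orth_of_card_lt hH π κ d e haut (by norm_num) (by decide) hκ hlt hu hu' huu').1

/-- **Order 37: the two fixed rows of H(668) are orthogonal on the two fixed columns** (fixed 2×2 submatrix = H(2)). -/
theorem hadamard668_fixedSubmatrix_37 {H : Matrix ι ι ℤ} (hH : IsHadamardMatrix H) (hι : Fintype.card ι = 668)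
    (π κ : Equiv.Perm ι) (d e : ι → ℤ) (haut : IsSignedAut H π κ d e)
    (hπ : π ^ 37 = 1) (hκ : κ ^ 37 = 1) (hne : π ≠ 1 ∨ κ ≠ 1) :
    (univ.filter fun i => π i = i).card = 2 ∧ (univ.filter fun j => κ j = j).card = 2 ∧
    ∀ u u' : ι, π u = u → π u' = u' → u ≠ u' →
      ∑ j ∈ univ.filter (fun j => κ j = j), H u j * H u' j = 0 := by
  have hcount := hadamard668_fixedRows_37 hH hι π κ d e haut hπ hκ hne
  refine ⟨hcount.1, hcount.2, ?_⟩
  intro u u' hu hu' huu'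
  have hlt : (univ.filter fun j => κ j = j).card < 37 := by rw [hcount.2]; norm_num
  exact (hadamard_fixedRows_orth_of_card_lt hH π κ d e haut (by norm_num) (by decide) hκ hlt hu hu' huu').1

end Summit.Ventures.DiscreteObjects.Hadamard
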